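import Literature.Computability.QuantumComplexity.QuantumAdvantageWave0
import Literature.Computability.QuantumComplexity.SolovayKitaev.Basic
import Literature.Computability.Cryptography.PlacementWords
import Literature.MathematicalPhysics.QuantumLattice.GaugeGroups
import HarnessLib

/-!
# The bridge from placement-level universality to Solovay–Kitaev instruction sets

Topic `Literature/Computability/QuantumComplexity`. The tree has two notions of a universal gate
set: the *placement-level* `Cryptography.QGateSet.IsUniversal` of the circuit model
(`QubitRegister.lean`: for all large `n`, the placements of the gates on `n` wires together with
the global phases generate a dense subgroup of `U(2ⁿ)`, `GeneratesDenselyModPhase`), and the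
*instruction sets* `IsUniversalGateSet` of the Solovay–Kitaev theorem `solovay_kitaev`
(`QuantumAdvantageWave0.lean`, quantum-advantage.S07: a finite inverse-closed subset of `SU(N)`
generating a dense subgroup; Dawson–Nielsen 2006, §2). The docstrings of `QGateSet.IsUniversal` and of
`BQPOver_eq_BQP` (`BQP.lean`) describe the bridge between them — project the placements to
`SU(2ⁿ)` by the admissible phases, all `2ⁿ`-th roots — as "a remark only, not claimed". This file
PROVES it, and derives the form of the Solovay–Kitaev theorem that the gate-compilation arguments
(`BQPOver_eq_BQP`, `PromiseBQPOver_eq_PromiseBQP`) consume: polylogarithmic-length *placement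
words* approximating every unitary up to a global phase.

* `suScaled S` — the `SU(N)`-rescalings `c • M` (`M ∈ S`, `c ∈ ℂ`) of a set `S` of matrices; for
  `S` finite it is finite (`suScaled_finite`: `c` is an `N`-th root of `(det M)⁻¹`).
* `dense_closure_suScaled` — if `S ⊆ U(N)` is nonempty and generates `U(N)` densely modulo phase,
  then `suScaled S` generates a dense subgroup of `SU(N)` (compactness: the phases times the closure
  `K` of `⟨suScaled S⟩` form a *closed* subgroup of `U(N)` containing the generators, hence all of
  `U(N)`; and the root-of-unity phases lie in `K`).
* `isUniversalGateSet_suScaled` — hence `suScaled S ∪ (suScaled S)⁻¹` is an `IsUniversalGateSet`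
  (Dawson–Nielsen's instruction set; Nielsen–Chuang App. 3).
* `exists_word_smul` — **Solovay–Kitaev for words over `S` up to a phase**: if moreover the
  inverse of each element of `S` is a word over `S`, then the Solovay–Kitaev theorem
  (`solovay_kitaev_holds`, Dawson–Nielsen Thm. 1, discharged in the tree) yields `C, c > 0` such
  that every unitary `U` is within `ε` (operator norm) of `a • l.prod` for a word `l` over `S` of
  length `≤ C log(1/ε)^c` and a phase `a`, `‖a‖ = 1`, for all `0 < ε ≤ 1/2`.
* The circuit-model specialisations: `placements_finite`, `nonempty_placements_of_generatesDenselyModPhase`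
  (on `n ≥ 1` wires a set generating densely modulo phase contains a unitary: the phases alone are a
  closed proper subgroup), `isUniversalGateSet_placements` (the bridge as stated in `BQP.lean`) and
  `exists_placementWord` / `QGateSet.IsUniversal.exists_placementWord` (polylog-length circuits
  over `G` approximating every unitary up to a phase, unconditionally).

No named fact is introduced; everything is proved.

## References

* C. M. Dawson, M. A. Nielsen, *The Solovay–Kitaev algorithm*, Quantum Inf. Comput. 6 (2006)
  81–95 = arXiv:quant-ph/0505030, §2 (instruction sets), Thm. 1 [DawsonNielsen2006].
* M. A. Nielsen, I. L. Chuang, *Quantum Computation and Quantum Information*, CUP 2010, §4.5.3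
  and App. 3, Thm. A3.1 (Solovay–Kitaev in `SU(2)`; "global phase is unobservable", Box 4.1)
  [NielsenChuang2010].
* A. Yu. Kitaev, A. H. Shen, M. N. Vyalyi, *Classical and Quantum Computation*, AMS GSM 47 (2002),
  §8.1 (realisation up to a phase factor), §8.3 (Thm. 8.5, efficient approximation over a
  complete basis) [KitaevShenVyalyi2002].
-/

noncomputable section

open scoped Matrix.Norms.L2Operator Pointwise

namespace Literature.Computability.QuantumComplexity

open Matrix

section Generic

variable {m : Type*} [Fintype m] [DecidableEq m]

/-! ### Phases and unitarity -/

/-- A unitary matrix has a determinant of modulus `1`. [folklore] -/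
theorem norm_det_eq_one_of_mem_unitaryGroup {M : Matrix m m ℂ}
    (hM : M ∈ Matrix.unitaryGroup m ℂ) : ‖M.det‖ = 1 := by
  have h := Matrix.mem_unitaryGroup_iff.1 hM
  have hdet := congrArg Matrix.det h
  rw [det_mul, det_one, star_eq_conjTranspose, det_conjTranspose] at hdet
  have h2 : ‖M.det‖ ^ 2 = 1 := by
    rw [← Complex.normSq_eq_norm_sq, ← Complex.ofReal_inj, Complex.ofReal_one, ← Complex.mul_conj]
    exact hdet
  nlinarith [norm_nonneg M.det]

/-- A unit phase times a unitary matrix is unitary. [folklore] -/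
theorem smul_mem_unitaryGroup_of_norm_eq_one {M : Matrix m m ℂ} (hM : M ∈ Matrix.unitaryGroup m ℂ) {c : ℂ}
    (hc : ‖c‖ = 1) : c • M ∈ Matrix.unitaryGroup m ℂ := by
  rw [Matrix.mem_unitaryGroup_iff] at hM ⊢
  have hcc : c * star c = 1 := by
    rw [Complex.star_def, Complex.mul_conj, Complex.normSq_eq_norm_sq, hc]
    simp
  rw [star_smul, smul_mul_smul_comm, hcc, one_smul, hM]

/-- If `M` and `c • M` are both unitary (on a nonempty index type) then `‖c‖ = 1`. [folklore] -/
theorem norm_eq_one_of_smul_mem_unitaryGroup [Nonempty m] {M : Matrix m m ℂ}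
    (hM : M ∈ Matrix.unitaryGroup m ℂ) {c : ℂ} (h : c • M ∈ Matrix.unitaryGroup m ℂ) :
    ‖c‖ = 1 := by
  have h1 := Matrix.mem_unitaryGroup_iff.1 h
  rw [star_smul, smul_mul_smul_comm, Matrix.mem_unitaryGroup_iff.1 hM] at h1
  obtain ⟨i⟩ := ‹Nonempty m›
  have h2 := congrFun (congrFun h1 i) i
  simp only [Matrix.smul_apply, Matrix.one_apply_eq, smul_eq_mul, mul_one] at h2
  have h3 : ‖c‖ ^ 2 = 1 := by
    rw [← Complex.normSq_eq_norm_sq, ← Complex.ofReal_inj, Complex.ofReal_one, ← Complex.mul_conj]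
    exact h2
  nlinarith [norm_nonneg c]

/-- **Admissible phases**: a unitary matrix (on a nonempty index type) has a unit-phase multiple in
`SU(N)` — take an `N`-th root of `(det M)⁻¹`. [cite: NielsenChuang2010, App. 3] -/
theorem exists_smul_mem_specialUnitaryGroup [Nonempty m] {M : Matrix m m ℂ}
    (hM : M ∈ Matrix.unitaryGroup m ℂ) :
    ∃ c : ℂ, ‖c‖ = 1 ∧ c • M ∈ Matrix.specialUnitaryGroup m ℂ := by
  have hd : 0 < Fintype.card m := Fintype.card_pos
  obtain ⟨c, hc⟩ := IsAlgClosed.exists_pow_nat_eq (M.det)⁻¹ hd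
  have hdet1 : ‖M.det‖ = 1 := norm_det_eq_one_of_mem_unitaryGroup hM
  have hcn : ‖c‖ = 1 := by
    have : ‖c‖ ^ Fintype.card m = 1 := by rw [← norm_pow, hc, norm_inv, hdet1, inv_one]
    exact (pow_eq_one_iff_of_nonneg (norm_nonneg c) hd.ne').1 this
  refine ⟨c, hcn, Matrix.mem_specialUnitaryGroup_iff.2 ⟨smul_mem_unitaryGroup_of_norm_eq_one hM hcn, ?_⟩⟩
  rw [det_smul, hc, inv_mul_cancel₀]
  intro h0
  rw [h0, norm_zero] at hdet1
  exact zero_ne_one hdet1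

/-! ### The `SU(N)`-rescalings of a set of matrices -/

/-- **`suScaled S`**: the elements of `SU(N)` of the form `c • M` with `M ∈ S` and `c ∈ ℂ` — the
"`SU`-projections" of the (unitary) elements of `S` by all admissible phases (all the `N`-th roots
of `(det M)⁻¹`). [cite: NielsenChuang2010, App. 3 (reduction to `SU(2)`)] [cite: DawsonNielsen2006, §2] -/
def suScaled (S : Set (Matrix m m ℂ)) : Set (Matrix.specialUnitaryGroup m ℂ) :=
  {V | ∃ M ∈ S, ∃ c : ℂ, (V : Matrix m m ℂ) = c • M}

/-- Unfolding lemma for `suScaled`. [folklore] -/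
theorem mem_suScaled_iff {S : Set (Matrix m m ℂ)} {V : Matrix.specialUnitaryGroup m ℂ} :
    V ∈ suScaled S ↔ ∃ M ∈ S, ∃ c : ℂ, (V : Matrix m m ℂ) = c • M :=
  Iff.rfl

/-- `suScaled` is monotone. [folklore] -/
theorem suScaled_mono {S T : Set (Matrix m m ℂ)} (h : S ⊆ T) : suScaled S ⊆ suScaled T := by
  rintro V ⟨M, hM, c, hc⟩
  exact ⟨M, h hM, c, hc⟩

/-- **`suScaled S` is finite when `S` is**: over a fixed `M`, the phase `c` of an element `c • M` of
`SU(N)` is an `N`-th root of `(det M)⁻¹`. [cite: NielsenChuang2010, App. 3] -/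
theorem suScaled_finite {S : Set (Matrix m m ℂ)} (hS : S.Finite) : (suScaled S).Finite := by
  have hsub : suScaled S ⊆ ⋃ M ∈ S,
      {V : Matrix.specialUnitaryGroup m ℂ | ∃ c : ℂ, (V : Matrix m m ℂ) = c • M} := by
    rintro V ⟨M, hM, c, hc⟩
    exact Set.mem_biUnion hM ⟨c, hc⟩
  refine (hS.biUnion fun M _ => ?_).subset hsub
  rcases isEmpty_or_nonempty m with hm | hm
  · haveI : Subsingleton (Matrix.specialUnitaryGroup m ℂ) := ⟨fun a b => Subtype.ext (Subsingleton.elim _ _)⟩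
    exact Set.subsingleton_of_subsingleton.finite
  · have hd : 0 < Fintype.card m := Fintype.card_pos
    refine Set.Finite.of_finite_image ?_ Subtype.val_injective.injOn
    have himg : Subtype.val '' {V : Matrix.specialUnitaryGroup m ℂ | ∃ c : ℂ, (V : Matrix m m ℂ) = c • M} ⊆
        (fun c : ℂ => c • M) '' (↑(Polynomial.nthRootsFinset (Fintype.card m) (M.det)⁻¹) : Set ℂ) := by
      rintro _ ⟨V, ⟨c, hc⟩, rfl⟩
      refine ⟨c, ?_, hc.symm⟩
      have hV := (Matrix.mem_specialUnitaryGroup_iff.1 V.2).2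
      rw [hc, det_smul] at hV
      rw [Finset.mem_coe, Polynomial.mem_nthRootsFinset hd]
      exact eq_inv_of_mul_eq_one_left hV
    exact ((Finset.finite_toSet _).image _).subset himg

/-! ### Density in `SU(N)` from density modulo phase in `U(N)` -/

/-- **Density transfer.** If `S ⊆ U(N)` is nonempty and the unitary elements of `S` together with
the global phases generate a dense subgroup of `U(N)` (`GeneratesDenselyModPhase`), then
`suScaled S` generates a dense subgroup of `SU(N)`. Proof: with `K` the closure of `⟨suScaled S⟩`
in `SU(N)`, the set `{c • W | ‖c‖ = 1, W ∈ K}` is a closed (compact image) subgroup of `U(N)`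
containing `S` and the phases, hence everything; so every `V ∈ SU(N)` is `c • W` with
`c^N = 1`, and `c • 1 = ((c c₀) • M₀)(c₀ • M₀)⁻¹ ∈ K` for any `M₀ ∈ S`.
[cite: NielsenChuang2010, App. 3] [cite: DawsonNielsen2006, §2] -/
theorem dense_closure_suScaled [Nonempty m] {S : Set (Matrix m m ℂ)}
    (hSU : S ⊆ (Matrix.unitaryGroup m ℂ : Set (Matrix m m ℂ))) (hne : S.Nonempty)
    (hdense : Dense ((Subgroup.closure {U : Matrix.unitaryGroup m ℂ |
      U.1 ∈ S ∨ ∃ c : ℂ, U.1 = c • (1 : Matrix m m ℂ)}) : Set (Matrix.unitaryGroup m ℂ))) :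
    Dense ((Subgroup.closure (suScaled S)) : Set (Matrix.specialUnitaryGroup m ℂ)) := by
  set K : Subgroup (Matrix.specialUnitaryGroup m ℂ) :=
    (Subgroup.closure (suScaled S)).topologicalClosure with hK
  have hPK : Subgroup.closure (suScaled S) ≤ K := Subgroup.le_topologicalClosure _
  suffices htop : (K : Set (Matrix.specialUnitaryGroup m ℂ)) = Set.univ by
    rw [dense_iff_closure_eq, ← Subgroup.topologicalClosure_coe]
    exact htop
  -- the subgroup `phases • K` of `U(N)`
  let K' : Subgroup (Matrix.unitaryGroup m ℂ) :=
    { carrier := {U | ∃ c : ℂ, ∃ W : Matrix.specialUnitaryGroup m ℂ, W ∈ K ∧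
        (U : Matrix m m ℂ) = c • (W : Matrix m m ℂ)}
      mul_mem' := by
        rintro U U' ⟨c, W, hW, hU⟩ ⟨c', W', hW', hU'⟩
        refine ⟨c * c', W * W', K.mul_mem hW hW', ?_⟩
        rw [Submonoid.coe_mul, hU, hU', smul_mul_smul_comm]
        rfl
      one_mem' := ⟨1, 1, K.one_mem, by simp⟩
      inv_mem' := by
        rintro U ⟨c, W, hW, hU⟩
        refine ⟨star c, W⁻¹, K.inv_mem hW, ?_⟩
        rw [← Unitary.star_eq_inv, Unitary.coe_star, hU, star_smul]
        rfl }
  have hmemK' : ∀ U : Matrix.unitaryGroup m ℂ, U ∈ K' ↔ ∃ c : ℂ, ∃ W : Matrix.specialUnitaryGroup m ℂ,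
      W ∈ K ∧ (U : Matrix m m ℂ) = c • (W : Matrix m m ℂ) := fun U => Iff.rfl
  -- generators lie in `K'`
  have hgen : {U : Matrix.unitaryGroup m ℂ | U.1 ∈ S ∨ ∃ c : ℂ, U.1 = c • (1 : Matrix m m ℂ)} ⊆ K' := by
    rintro U (hU | ⟨c, hc⟩)
    · obtain ⟨c, hc1, hcM⟩ := exists_smul_mem_specialUnitaryGroup (hSU hU)
      have hc0 : c ≠ 0 := fun h0 => by rw [h0, norm_zero] at hc1; exact zero_ne_one hc1
      refine (hmemK' U).2 ⟨c⁻¹, ⟨c • U.1, hcM⟩, hPK (Subgroup.subset_closure ⟨U.1, hU, c, rfl⟩), ?_⟩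
      show (U : Matrix m m ℂ) = c⁻¹ • (c • (U : Matrix m m ℂ))
      rw [smul_smul, inv_mul_cancel₀ hc0, one_smul]
    · exact (hmemK' U).2 ⟨c, 1, K.one_mem, by simpa using hc⟩
  have hle : Subgroup.closure {U : Matrix.unitaryGroup m ℂ | U.1 ∈ S ∨ ∃ c : ℂ, U.1 = c • (1 : Matrix m m ℂ)} ≤ K' :=
    (Subgroup.closure_le K').2 hgen
  -- `K'` is closed: it is the preimage of the compact set `sphere • K`
  have hKc : IsClosed (K : Set (Matrix.specialUnitaryGroup m ℂ)) :=
    Subgroup.isClosed_topologicalClosure _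
  have hK'eq : (K' : Set (Matrix.unitaryGroup m ℂ)) = Subtype.val ⁻¹'
      ((fun p : ℂ × Matrix.specialUnitaryGroup m ℂ => p.1 • (p.2 : Matrix m m ℂ)) ''
        (Metric.sphere (0 : ℂ) 1 ×ˢ (K : Set (Matrix.specialUnitaryGroup m ℂ)))) := by
    ext U
    constructor
    · rintro ⟨c, W, hW, hU⟩
      refine ⟨(c, W), ⟨?_, hW⟩, hU.symm⟩
      have hc : ‖c‖ = 1 := norm_eq_one_of_smul_mem_unitaryGroup W.2.1 (hU ▸ U.2)
      simpa using hc
    · rintro ⟨⟨c, W⟩, ⟨-, hW⟩, hU⟩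
      exact ⟨c, W, hW, hU.symm⟩
  have hK'c : IsClosed (K' : Set (Matrix.unitaryGroup m ℂ)) := by
    rw [hK'eq]
    refine IsClosed.preimage continuous_subtype_val (IsCompact.isClosed ?_)
    refine ((isCompact_sphere (0 : ℂ) 1).prod hKc.isCompact).image ?_
    exact continuous_fst.smul (continuous_subtype_val.comp continuous_snd)
  -- hence `K' = U(N)`
  have hK'top : (K' : Set (Matrix.unitaryGroup m ℂ)) = Set.univ := by
    have h1 : Dense (K' : Set (Matrix.unitaryGroup m ℂ)) := hdense.mono (SetLike.coe_subset_coe.2 hle)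
    rw [← hK'c.closure_eq, h1.closure_eq]
  -- the root-of-unity phases lie in `K`
  obtain ⟨M₀, hM₀⟩ := hne
  obtain ⟨c₀, hc₀1, hc₀M⟩ := exists_smul_mem_specialUnitaryGroup (hSU hM₀)
  have hc₀c : c₀ * star c₀ = 1 := by
    rw [Complex.star_def, Complex.mul_conj, Complex.normSq_eq_norm_sq, hc₀1]
    simp
  have hphase : ∀ (ζ : ℂ) (hζ : ζ • (1 : Matrix m m ℂ) ∈ Matrix.specialUnitaryGroup m ℂ),
      (⟨ζ • 1, hζ⟩ : Matrix.specialUnitaryGroup m ℂ) ∈ K := by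
    intro ζ hζ
    have hζ1 : ‖ζ‖ = 1 := norm_eq_one_of_smul_mem_unitaryGroup (Submonoid.one_mem _) hζ.1
    have hζd : ζ ^ Fintype.card m = 1 := by
      have := (Matrix.mem_specialUnitaryGroup_iff.1 hζ).2
      rwa [det_smul, det_one, mul_one] at this
    have hW₁ : (ζ * c₀) • M₀ ∈ Matrix.specialUnitaryGroup m ℂ := by
      refine Matrix.mem_specialUnitaryGroup_iff.2 ⟨smul_mem_unitaryGroup_of_norm_eq_one (hSU hM₀) (by rw [norm_mul, hζ1, hc₀1, one_mul]), ?_⟩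
      rw [det_smul, mul_pow, hζd, one_mul, ← det_smul]
      exact (Matrix.mem_specialUnitaryGroup_iff.1 hc₀M).2
    have hprod : (⟨ζ • 1, hζ⟩ : Matrix.specialUnitaryGroup m ℂ) =
        ⟨(ζ * c₀) • M₀, hW₁⟩ * (⟨c₀ • M₀, hc₀M⟩ : Matrix.specialUnitaryGroup m ℂ)⁻¹ := by
      apply Subtype.ext
      show ζ • (1 : Matrix m m ℂ) = ((ζ * c₀) • M₀) * star (c₀ • M₀)
      rw [star_smul, smul_mul_smul_comm, Matrix.mem_unitaryGroup_iff.1 (hSU hM₀), mul_assoc, hc₀c,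
        mul_one]
    rw [hprod]
    exact K.mul_mem (hPK (Subgroup.subset_closure ⟨M₀, hM₀, ζ * c₀, rfl⟩))
      (K.inv_mem (hPK (Subgroup.subset_closure ⟨M₀, hM₀, c₀, rfl⟩)))
  -- conclusion
  ext V
  simp only [Set.mem_univ, iff_true]
  have hVK' : (⟨V.1, V.2.1⟩ : Matrix.unitaryGroup m ℂ) ∈ (K' : Set (Matrix.unitaryGroup m ℂ)) := by
    rw [hK'top]; trivial
  obtain ⟨c, W, hW, hVW⟩ := hVK'
  have hVW' : (V : Matrix m m ℂ) = c • (W : Matrix m m ℂ) := hVW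
  have hWW : (W : Matrix m m ℂ) * star (W : Matrix m m ℂ) = 1 := Matrix.mem_unitaryGroup_iff.1 W.2.1
  have hc1 : c • (1 : Matrix m m ℂ) = (V : Matrix m m ℂ) * star (W : Matrix m m ℂ) := by
    rw [hVW', smul_mul_assoc, hWW]
  have hζ : c • (1 : Matrix m m ℂ) ∈ Matrix.specialUnitaryGroup m ℂ := by
    rw [hc1]
    exact (V * W⁻¹).2
  have hV : V = ⟨c • 1, hζ⟩ * W := by
    apply Subtype.ext
    show (V : Matrix m m ℂ) = c • (1 : Matrix m m ℂ) * (W : Matrix m m ℂ)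
    rw [smul_mul_assoc, one_mul, hVW']
  rw [hV]
  exact K.mul_mem (hphase c hζ) hW

/-- **The bridge** (`QGateSet.IsUniversal` docstring, `BQP.lean` module docstring, made a theorem):
for `S ⊆ U(N)` finite, nonempty and generating `U(N)` densely modulo phase, the `SU(N)`-rescalings
of its elements together with their inverses form an instruction set in the sense of Dawson–Nielsen
— finite, inverse-closed, generating a dense subgroup of `SU(N)`. [cite: DawsonNielsen2006, §2] [cite: NielsenChuang2010, App. 3] -/
theorem isUniversalGateSet_suScaled [Nonempty m] {S : Set (Matrix m m ℂ)} (hfin : S.Finite)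
    (hSU : S ⊆ (Matrix.unitaryGroup m ℂ : Set (Matrix m m ℂ))) (hne : S.Nonempty)
    (hdense : Dense ((Subgroup.closure {U : Matrix.unitaryGroup m ℂ |
      U.1 ∈ S ∨ ∃ c : ℂ, U.1 = c • (1 : Matrix m m ℂ)}) : Set (Matrix.unitaryGroup m ℂ))) :
    IsUniversalGateSet (suScaled S ∪ (suScaled S)⁻¹) where
  finite := (suScaled_finite hfin).union (suScaled_finite hfin).inv
  inv_mem := by
    rintro g (hg | hg)
    · exact Or.inr (Set.inv_mem_inv.2 hg)
    · exact Or.inl (Set.mem_inv.1 hg)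
  dense_closure := (dense_closure_suScaled hSU hne hdense).mono
    (SetLike.coe_subset_coe.2 (Subgroup.closure_mono Set.subset_union_left))

/-! ### Solovay–Kitaev for words over `S`, up to a phase -/

/-- Letters of the instruction set expand into words over `S` times a phase: an element of
`suScaled S` is `c • M`, and an element of `(suScaled S)⁻¹` is `c̄ • M⁻¹` where `M⁻¹` is a word over
`S` when `S` is inverse-closed as words. [cite: DawsonNielsen2006, §2 (the remark after Def. 1)] -/
theorem exists_word_of_mem_suScaled_union_inv [Nonempty m] {S : Set (Matrix m m ℂ)}
    (hSU : S ⊆ (Matrix.unitaryGroup m ℂ : Set (Matrix m m ℂ)))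
    (hinv : ∀ M ∈ S, ∃ l : List (Matrix m m ℂ), (∀ N ∈ l, N ∈ S) ∧ l.prod * M = 1)
    {g : Matrix.specialUnitaryGroup m ℂ} (hg : g ∈ suScaled S ∪ (suScaled S)⁻¹) :
    ∃ (l : List (Matrix m m ℂ)) (a : ℂ), (∀ N ∈ l, N ∈ S) ∧ ‖a‖ = 1 ∧
      (g : Matrix m m ℂ) = a • l.prod := by
  rcases hg with ⟨M, hM, c, hc⟩ | hg
  · refine ⟨[M], c, by simpa using hM, ?_, by simpa using hc⟩
    exact norm_eq_one_of_smul_mem_unitaryGroup (hSU hM) (hc ▸ g.2.1)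
  · obtain ⟨M, hM, c, hc⟩ := Set.mem_inv.1 hg
    obtain ⟨l, hl, hlM⟩ := hinv M hM
    have hMu : M * star M = 1 := Matrix.mem_unitaryGroup_iff.1 (hSU hM)
    have hstar : star M = l.prod := by
      calc star M = (l.prod * M) * star M := by rw [hlM, one_mul]
        _ = l.prod := by rw [mul_assoc, hMu, mul_one]
    have hcn : ‖c‖ = 1 := norm_eq_one_of_smul_mem_unitaryGroup (hSU hM) (hc ▸ (g⁻¹).2.1)
    refine ⟨l, star c, hl, by rwa [norm_star], ?_⟩
    have hg' : (g : Matrix m m ℂ) = star ((g⁻¹ : Matrix.specialUnitaryGroup m ℂ) : Matrix m m ℂ) := by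
      rw [SolovayKitaev.coe_inv, star_star]
    rw [hg', hc, star_smul, hstar]

/-- The product of a word over the instruction set is a phase times the product of the
concatenated `S`-words, of length at most `B` per letter. [folklore] -/
theorem exists_word_of_list {S : Set (Matrix m m ℂ)} {T : Set (Matrix.specialUnitaryGroup m ℂ)}
    (fl : Matrix.specialUnitaryGroup m ℂ → List (Matrix m m ℂ)) (fa : Matrix.specialUnitaryGroup m ℂ → ℂ)
    {B : ℕ} (hf : ∀ g ∈ T, (∀ N ∈ fl g, N ∈ S) ∧ (fl g).length ≤ B ∧ ‖fa g‖ = 1 ∧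
      (g : Matrix m m ℂ) = fa g • (fl g).prod) :
    ∀ w : List (Matrix.specialUnitaryGroup m ℂ), (∀ g ∈ w, g ∈ T) →
      ∃ (l : List (Matrix m m ℂ)) (a : ℂ), (∀ N ∈ l, N ∈ S) ∧ l.length ≤ B * w.length ∧ ‖a‖ = 1 ∧
        ((w.prod : Matrix.specialUnitaryGroup m ℂ) : Matrix m m ℂ) = a • l.prod
  | [], _ => ⟨[], 1, by simp, by simp, norm_one, by simp⟩
  | g :: w, hw => by
    obtain ⟨hgl, hgB, hga, hg⟩ := hf g (hw g List.mem_cons_self)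
    obtain ⟨l, a, hl, hlB, ha, hwp⟩ :=
      exists_word_of_list fl fa hf w fun g' hg' => hw g' (List.mem_cons_of_mem g hg')
    refine ⟨fl g ++ l, fa g * a, fun N hN => ?_, ?_, by rw [norm_mul, hga, ha, one_mul], ?_⟩
    · rcases List.mem_append.1 hN with h | h
      · exact hgl N h
      · exact hl N h
    · rw [List.length_append, List.length_cons]
      nlinarith
    · rw [List.prod_cons, Submonoid.coe_mul, hg, hwp, List.prod_append, smul_mul_smul_comm]

/-- **Solovay–Kitaev for words over `S`, up to a global phase.** Let `S ⊆ U(N)` (nonempty index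
type) be finite and nonempty, inverse-closed as words (`∀ M ∈ S`, some word over `S` is a left
inverse of `M`), and generate `U(N)` densely modulo phase. Then the Solovay–Kitaev theorem
(`solovay_kitaev_holds`, for `SU(N)`, applied to the instruction set `suScaled S ∪ (suScaled S)⁻¹`)
yields constants `C, c > 0` such that for all `0 < ε ≤ 1/2` every unitary `U` is within `ε`, in
the `L²`-operator norm, of `a • l.prod` for some word `l` over `S` of length `≤ C · log(1/ε)^c`
and some phase `a` with `‖a‖ = 1`. [cite: DawsonNielsen2006, Thm. 1] [cite: NielsenChuang2010, App. 3, Thm. A3.1] -/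
theorem exists_word_smul [Nonempty m] {S : Set (Matrix m m ℂ)} (hfin : S.Finite)
    (hSU : S ⊆ (Matrix.unitaryGroup m ℂ : Set (Matrix m m ℂ))) (hne : S.Nonempty)
    (hinv : ∀ M ∈ S, ∃ l : List (Matrix m m ℂ), (∀ N ∈ l, N ∈ S) ∧ l.prod * M = 1)
    (hdense : Dense ((Subgroup.closure {U : Matrix.unitaryGroup m ℂ |
      U.1 ∈ S ∨ ∃ c : ℂ, U.1 = c • (1 : Matrix m m ℂ)}) : Set (Matrix.unitaryGroup m ℂ))) :
    ∃ C c : ℝ, 0 < C ∧ 0 < c ∧ ∀ ε : ℝ, 0 < ε → ε ≤ 1 / 2 →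
      ∀ U ∈ Matrix.unitaryGroup m ℂ,
        ∃ (l : List (Matrix m m ℂ)) (a : ℂ), (∀ N ∈ l, N ∈ S) ∧
          (l.length : ℝ) ≤ C * Real.log (1 / ε) ^ c ∧ ‖a‖ = 1 ∧ ‖l.prod - a • U‖ ≤ ε := by
  set T : Set (Matrix.specialUnitaryGroup m ℂ) := suScaled S ∪ (suScaled S)⁻¹ with hT
  have hTU : IsUniversalGateSet T := isUniversalGateSet_suScaled hfin hSU hne hdense
  obtain ⟨C, c, hC, hc, hCc⟩ := solovay_kitaev_holds hTU
  -- expansion of letters, with a uniform length bound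
  have key : ∀ g ∈ T, ∃ (l : List (Matrix m m ℂ)) (a : ℂ), (∀ N ∈ l, N ∈ S) ∧ ‖a‖ = 1 ∧
      (g : Matrix m m ℂ) = a • l.prod := fun g hg => exists_word_of_mem_suScaled_union_inv hSU hinv hg
  choose! fl fa hfl using key
  set B : ℕ := hTU.finite.toFinset.sup fun g => (fl g).length with hB
  have hf : ∀ g ∈ T, (∀ N ∈ fl g, N ∈ S) ∧ (fl g).length ≤ B ∧ ‖fa g‖ = 1 ∧
      (g : Matrix m m ℂ) = fa g • (fl g).prod := by
    intro g hg
    obtain ⟨h1, h2, h3⟩ := hfl g hg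
    exact ⟨h1, Finset.le_sup (f := fun g => (fl g).length) (hTU.finite.mem_toFinset.2 hg), h2, h3⟩
  refine ⟨(B + 1) * C, c, by positivity, hc, fun ε hε hε2 U hUu => ?_⟩
  obtain ⟨c₀, hc₀, hV⟩ := exists_smul_mem_specialUnitaryGroup hUu
  obtain ⟨w, hwT, hwlen, hwdist⟩ := hCc ε hε hε2 ⟨c₀ • U, hV⟩
  obtain ⟨l, a, hl, hlB, ha, hwp⟩ := exists_word_of_list fl fa hf w hwT
  have hac : star a * a = 1 := by
    rw [Complex.star_def, ← Complex.normSq_eq_conj_mul_self, Complex.normSq_eq_norm_sq, ha]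
    simp
  refine ⟨l, star a * c₀, hl, ?_, by rw [norm_mul, norm_star, ha, hc₀, one_mul], ?_⟩
  · have hlog : 0 ≤ Real.log (1 / ε) := Real.log_nonneg ((one_le_div hε).2 (by linarith))
    have hpow : 0 ≤ Real.log (1 / ε) ^ c := Real.rpow_nonneg hlog c
    have h1 : (l.length : ℝ) ≤ B * w.length := by exact_mod_cast hlB
    calc (l.length : ℝ) ≤ B * w.length := h1
      _ ≤ B * (C * Real.log (1 / ε) ^ c) := by gcongr
      _ ≤ (B + 1) * C * Real.log (1 / ε) ^ c := by nlinarith [mul_nonneg hC.le hpow]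
  · have hdist : ‖a • l.prod - c₀ • U‖ ≤ ε := by
      have : ((w.prod : Matrix.specialUnitaryGroup m ℂ) : Matrix m m ℂ) = a • l.prod := hwp
      rw [← this]
      exact hwdist
    calc ‖l.prod - (star a * c₀) • U‖ = ‖star a • (a • l.prod - c₀ • U)‖ := by
          rw [smul_sub, smul_smul, hac, one_smul, smul_smul]
      _ = ‖a • l.prod - c₀ • U‖ := by rw [norm_smul, norm_star, ha, one_mul]
      _ ≤ ε := hdist

end Generic

/-! ### The circuit model: placements of a finite gate set -/

section Placements

open Cryptography

variable {G : QGateSet} {n : ℕ}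

/-- The placements of a finite gate set on `n` wires form a finite set (finitely many gate symbols,
finitely many wire embeddings). [folklore] -/
theorem placements_finite [Finite G.Op] (n : ℕ) : (placements G n).Finite := by
  have h : placements G n = Set.range
      (fun p : Σ g : G.Op, (Fin (G.arity g) ↪ Fin n) => placeGate p.2 (G.mat p.1)) := by
    ext M
    constructor
    · rintro ⟨g, e, rfl⟩
      exact ⟨⟨g, e⟩, rfl⟩
    · rintro ⟨⟨g, e⟩, rfl⟩
      exact ⟨g, e, rfl⟩
  rw [h]
  exact Set.finite_range _

/-- A non-scalar unitary on `n ≥ 1` wires: the Pauli `Z` on wire `0` as a diagonal `±1` matrix.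
[cite: NielsenChuang2010, §4.2] -/
theorem exists_unitary_ne_smul_one (hn : 1 ≤ n) :
    ∃ D ∈ Matrix.unitaryGroup (QReg n) ℂ, ∀ c : ℂ, D ≠ c • (1 : Matrix (QReg n) (QReg n) ℂ) := by
  let i0 : Fin n := ⟨0, hn⟩
  refine ⟨Matrix.diagonal fun x : QReg n => if x i0 then (-1 : ℂ) else 1, ?_, fun c hc => ?_⟩
  · rw [Matrix.mem_unitaryGroup_iff, star_eq_conjTranspose, diagonal_conjTranspose, diagonal_mul_diagonal,
      ← diagonal_one]
    congr 1
    funext x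
    by_cases hx : x i0 <;> simp [hx]
  · have h0 := congrFun (congrFun hc (fun _ => false)) (fun _ => false)
    have h1 := congrFun (congrFun hc (fun _ => true)) (fun _ => true)
    simp only [diagonal_apply_eq, Matrix.smul_apply, Matrix.one_apply_eq, smul_eq_mul, mul_one] at h0 h1
    simp at h0 h1
    rw [← h0] at h1
    norm_num at h1

/-- **On `n ≥ 1` wires, a set generating `U(2ⁿ)` densely modulo phase contains a unitary**: the
phases alone form a closed subgroup (a compact image of the circle), which is proper since the Pauli
`Z` is not a phase. [cite: NielsenChuang2010, §4.5.3] -/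
theorem nonempty_inter_unitaryGroup_of_generatesDenselyModPhase {S : Set (Matrix (QReg n) (QReg n) ℂ)}
    (h : GeneratesDenselyModPhase n S) (hn : 1 ≤ n) :
    (S ∩ (Matrix.unitaryGroup (QReg n) ℂ : Set (Matrix (QReg n) (QReg n) ℂ))).Nonempty := by
  by_contra hS
  rw [Set.not_nonempty_iff_eq_empty] at hS
  -- the phases form a subgroup `Z` of `U(2ⁿ)`
  let Z : Subgroup (Matrix.unitaryGroup (QReg n) ℂ) :=
    { carrier := {U | ∃ c : ℂ, (U : Matrix (QReg n) (QReg n) ℂ) = c • 1}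
      mul_mem' := by
        rintro U U' ⟨c, hU⟩ ⟨c', hU'⟩
        refine ⟨c * c', ?_⟩
        rw [Submonoid.coe_mul, hU, hU', smul_mul_smul_comm, one_mul]
      one_mem' := ⟨1, by simp⟩
      inv_mem' := by
        rintro U ⟨c, hU⟩
        refine ⟨star c, ?_⟩
        rw [← Unitary.star_eq_inv, Unitary.coe_star, hU, star_smul, star_one] }
  have hgen : {U : Matrix.unitaryGroup (QReg n) ℂ | U.1 ∈ S ∨ ∃ c : ℂ, U.1 = c • (1 : Matrix _ _ ℂ)} ⊆ Z := by
    rintro U (hU | ⟨c, hc⟩)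
    · exfalso
      have : (U : Matrix (QReg n) (QReg n) ℂ) ∈ S ∩ (Matrix.unitaryGroup (QReg n) ℂ : Set _) := ⟨hU, U.2⟩
      rw [hS] at this
      exact this
    · exact ⟨c, hc⟩
  have hle := (Subgroup.closure_le Z).2 hgen
  -- `Z` is closed
  have hZeq : (Z : Set (Matrix.unitaryGroup (QReg n) ℂ)) = Subtype.val ⁻¹'
      ((fun c : ℂ => c • (1 : Matrix (QReg n) (QReg n) ℂ)) '' Metric.sphere (0 : ℂ) 1) := by
    ext U
    constructor
    · rintro ⟨c, hU⟩
      refine ⟨c, ?_, hU.symm⟩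
      have hc : ‖c‖ = 1 := norm_eq_one_of_smul_mem_unitaryGroup (Submonoid.one_mem _) (hU ▸ U.2)
      simpa using hc
    · rintro ⟨c, -, hU⟩
      exact ⟨c, hU.symm⟩
  have hZc : IsClosed (Z : Set (Matrix.unitaryGroup (QReg n) ℂ)) := by
    rw [hZeq]
    refine IsClosed.preimage continuous_subtype_val (IsCompact.isClosed ?_)
    exact (isCompact_sphere (0 : ℂ) 1).image (continuous_id.smul continuous_const)
  have hZtop : (Z : Set (Matrix.unitaryGroup (QReg n) ℂ)) = Set.univ := by
    have h1 : Dense (Z : Set (Matrix.unitaryGroup (QReg n) ℂ)) := by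
      unfold GeneratesDenselyModPhase at h
      exact h.mono (SetLike.coe_subset_coe.2 hle)
    rw [← hZc.closure_eq, h1.closure_eq]
  obtain ⟨D, hD, hDne⟩ := exists_unitary_ne_smul_one hn
  have hDZ : (⟨D, hD⟩ : Matrix.unitaryGroup (QReg n) ℂ) ∈ (Z : Set (Matrix.unitaryGroup (QReg n) ℂ)) := by
    rw [hZtop]; trivial
  obtain ⟨c, hc⟩ := hDZ
  exact hDne c hc

/-- On `n ≥ 1` wires, a unitary gate set whose placements generate densely modulo phase has a
placement there (in particular its alphabet is nonempty). [cite: NielsenChuang2010, §4.5.3] -/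
theorem nonempty_placements_of_generatesDenselyModPhase
    (h : GeneratesDenselyModPhase n (placements G n)) (hn : 1 ≤ n) : (placements G n).Nonempty := by
  obtain ⟨M, hM, -⟩ := nonempty_inter_unitaryGroup_of_generatesDenselyModPhase h hn
  exact ⟨M, hM⟩

/-- **The bridge of `BQP.lean`, as a theorem**: for a finite unitary gate set whose placements on
`n ≥ 1` wires generate `U(2ⁿ)` densely modulo phase, the `SU(2ⁿ)`-projections of the placements
(all admissible phases) with their inverses form a Dawson–Nielsen instruction set
`IsUniversalGateSet` in `SU(QReg n)`. [cite: DawsonNielsen2006, §2] [cite: NielsenChuang2010, App. 3] -/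
theorem isUniversalGateSet_placements [Finite G.Op] (hU : G.IsUnitary)
    (h : GeneratesDenselyModPhase n (placements G n)) (hn : 1 ≤ n) :
    IsUniversalGateSet (suScaled (placements G n) ∪ (suScaled (placements G n))⁻¹) :=
  isUniversalGateSet_suScaled (placements_finite n) (QGateSet.placements_subset_unitaryGroup_holds hU n)
    (nonempty_placements_of_generatesDenselyModPhase h hn) h

/-- **Solovay–Kitaev at the placement level.** For a finite, unitary, inverse-closed gate set whose
placements on `n ≥ 1` wires generate `U(2ⁿ)` densely modulo phase, the Solovay–Kitaev theorem for
`SU(QReg n)` gives `C, c > 0` such that for all `0 < ε ≤ 1/2` every `n`-wire unitary is within `ε`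
(operator norm) of `a • l.prod` for a placement word `l` (an honest circuit over `G`, no inverses)
of length `≤ C · log(1/ε)^c` and a phase `‖a‖ = 1`. [cite: DawsonNielsen2006, Thm. 1] [cite: NielsenChuang2010, §4.5.3 and App. 3] -/
theorem exists_placementWord [Finite G.Op] (hU : G.IsUnitary)
    (hinv : G.IsInverseClosed) (h : GeneratesDenselyModPhase n (placements G n)) (hn : 1 ≤ n) :
    ∃ C c : ℝ, 0 < C ∧ 0 < c ∧ ∀ ε : ℝ, 0 < ε → ε ≤ 1 / 2 →
      ∀ U ∈ Matrix.unitaryGroup (QReg n) ℂ,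
        ∃ (l : List (Matrix (QReg n) (QReg n) ℂ)) (a : ℂ), (∀ M ∈ l, M ∈ placements G n) ∧
          (l.length : ℝ) ≤ C * Real.log (1 / ε) ^ c ∧ ‖a‖ = 1 ∧ ‖l.prod - a • U‖ ≤ ε :=
  exists_word_smul (placements_finite n) (QGateSet.placements_subset_unitaryGroup_holds hU n)
    (nonempty_placements_of_generatesDenselyModPhase h hn) (hinv n) h

/-- **Universality, Solovay–Kitaev form.** For a finite, unitary, inverse-closed, universal gate
set there is a threshold `n₀ ≥ 1` such that on every register of `n ≥ n₀` wires the conclusion of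
`exists_placementWord` holds: polylogarithmic-length circuits over `G` approximate every
`n`-wire unitary up to a global phase.
[cite: DawsonNielsen2006, Thm. 1] [cite: NielsenChuang2010, §4.5.3 and App. 3] -/
theorem _root_.Literature.Computability.Cryptography.QGateSet.IsUniversal.exists_placementWord
    [Finite G.Op] (hU : G.IsUnitary) (hinv : G.IsInverseClosed) (huniv : G.IsUniversal) :
    ∃ n₀ : ℕ, 1 ≤ n₀ ∧ ∀ n ≥ n₀, ∃ C c : ℝ, 0 < C ∧ 0 < c ∧ ∀ ε : ℝ, 0 < ε → ε ≤ 1 / 2 →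
      ∀ U ∈ Matrix.unitaryGroup (QReg n) ℂ,
        ∃ (l : List (Matrix (QReg n) (QReg n) ℂ)) (a : ℂ), (∀ M ∈ l, M ∈ placements G n) ∧
          (l.length : ℝ) ≤ C * Real.log (1 / ε) ^ c ∧ ‖a‖ = 1 ∧ ‖l.prod - a • U‖ ≤ ε := by
  obtain ⟨n₀, hn₀⟩ := huniv
  refine ⟨max n₀ 1, le_max_right _ _, fun n hn => ?_⟩
  exact Literature.Computability.QuantumComplexity.exists_placementWord hU hinv
    (hn₀ n (le_of_max_le_left hn)) (le_of_max_le_right hn)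

end Placements

end Literature.Computability.QuantumComplexity

end
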